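import Mathlib.Analysis.SpecialFunctions.ExpDeriv
import Literature.Geometry.Lorentzian.KerrSchildWaveCauchyProblem
import HarnessLib

/-!
# The divergence-form wave operator on amplitude–phase (WKB) functions `a e^{κφ}`

(family `gr`; namespace `Literature.Geometry.Lorentzian.KerrSchild`; proved infrastructure for the
Gaussian-beam construction of Sbierski 2015 on Kerr–Schild charts — the file introduces no named
fact)

The Gaussian beams of Sbierski, Anal. PDE 8 (2015) (arXiv:1311.2477v2), are complex functions
`u_λ = a e^{iλφ}` on a Lorentzian manifold, and the first step of the whole theory is the expansion
of the wave operator on such a function (arXiv (2.9), the display `(boxulambda)` in the proof of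
Thm. 2.1/arXiv Thm. 1):

  `□(a e^{iλφ}) = e^{iλφ} ( −λ² a g⁻¹(dφ, dφ) + iλ (2 g⁻¹(dφ, da) + a □φ) + □a )`,

from which the three conditions of a Gaussian beam are read off (eikonal `g⁻¹(dφ, dφ)` vanishing to
second order along `γ`, transport `2 g⁻¹(dφ, da) + a □φ` vanishing along `γ`; arXiv Lemma 5) and,
with `|e^{iλφ}| = e^{−λ Im φ}`, the pointwise bound behind `‖□u_λ‖_{L²} ≤ C` (arXiv Lemma 4/5).

On the tree's Kerr–Schild charts the wave operator is the coordinate divergence-form operator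
`KerrSchild.waveOperator G u = ∑_μ ∂_μ (∑_ν G^{μν} ∂_ν u)` on **real** functions
(`KerrSchildWaveCauchyProblem.lean`; `Kerr.dalembertian_eq_waveOperator`,
`Kerr.dalembertian_eq_divergence`). This file supplies its complexification and the WKB identity:

* `KerrSchild.dC u x μ = ∂_μ u (x)` — coordinate partial derivatives of a complex function on `E4`
  (real Fréchet derivative along `E4.basisVector μ`);
* `KerrSchild.symbolC G x ζ ξ = ∑_{μν} G^{μν}(x) ζ_μ ξ_ν` — the complex-bilinear extension of the
  principal symbol / carré du champ `g⁻¹(ζ, ξ)` on component covectors (`symbolC_comm` for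
  symmetric `G`);
* `KerrSchild.waveOperatorC G u = ∑_μ ∂_μ (∑_ν G^{μν} ∂_ν u)` on complex `u`, with
  `re ∘ waveOperatorC = waveOperator ∘ re` and the same for `im` (`re_waveOperatorC`,
  `im_waveOperatorC`; `G` differentiable and `u ∈ C²` at the point), and
  `waveOperatorC (↑f) = ↑(waveOperator f)` (`waveOperatorC_ofReal`);
* `KerrSchild.dC_mul_cexp` — `∂_ν (a e^{κφ}) = e^{κφ} (∂_ν a + κ a ∂_ν φ)`;
* `KerrSchild.waveOperatorC_mul_cexp` — **the WKB identity** for every complex constant `κ`: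
  `□_G (a e^{κφ}) = e^{κφ} ( κ² a s(dφ, dφ) + κ (s(dφ, da) + s(da, dφ) + a □_G φ) + □_G a )`
  (`G` differentiable at the point, `a, φ ∈ C²` there; no symmetry needed), and its symmetric form
  `waveOperatorC_mul_cexp_of_symm` with `2 s(dφ, da)`; for `κ = iλ` this is arXiv (2.9);
* `KerrSchild.norm_cexp_I_mul` — `|e^{iλφ}| = e^{−λ Im φ}`;
  `KerrSchild.norm_waveOperatorC_beam_le`, `KerrSchild.abs_waveOperator_re_beam_le` — the pointwise
  bounds `|□_G (a e^{iλφ})|, |□_G Re(a e^{iλφ})| ≤ e^{−λ Im φ} (λ² |a| |s(dφ,dφ)| + |λ| |2 s(dφ,da) + a □_G φ| + |□_G a|)`;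
* `Kerr.dalembertian_re_beam` — on `Kerr.region a r₀` the d'Alembertian of `Kerr.smoothMetric` on
  `Re(a e^{κφ})` is the real part of the WKB expression for `G = Kerr.inverseMetric M a`
  (`Kerr.dalembertian_eq_divergence`, `Kerr.inverseMetric_symm`, `Kerr.contDiffAt_inverseMetric`),
  with the corresponding pointwise bound `Kerr.abs_dalembertian_re_beam_le`.

* the **energy densities of real beams** (§4, proof of the theorem and its third remark):
  polarisation `∑ T^{μν} ∂_μ Re u ∂_ν Re u = ½ Re s_T(du, dū) + ½ Re s_T(du, du)`
  (`sum_mul_re_mul_re`, `sum_mul_fderiv_re`, `re_symbolC_self_star`), the beam gradient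
  `d(A e^{iλφ}) = e^{iλφ}(dA + iλ A dφ)` (`dC_beam`), the split of the density of `Re(A e^{iλφ})`
  into the non-oscillatory part `½ e^{−2λ Im φ} Re s_T(w, w̄)` and the oscillatory part
  `½ Re(e^{2iλφ} s_T(w, w))`, `w = dA + iλ A dφ` (`sum_mul_fderiv_re_beam`), and the expansion of
  `s_T(w, w̄)` in powers of `λ` (`symbolC_beamCovector_star`; bilinearity lemmas `symbolC_add_*`,
  `symbolC_smul_*`).

Everything is pointwise calculus (product and chain rules for real Fréchet derivatives of
`ℂ`-valued functions, `HasFDerivAt.cexp`); the integrated statements (arXiv Lemmas 4 and 5, and the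
energy asymptotics of §4) combine these identities with
`Literature/Analysis/Asymptotics/GaussianDamping.lean` and
`Literature/Analysis/Asymptotics/DirectionalNonStationaryPhase.lean`.

## References

* J. Sbierski, *Characterisation of the energy of Gaussian beams on Lorentzian manifolds: with
  applications to black hole spacetimes*, Anal. PDE 8 (2015) 1379–1420, §2–§3; arXiv:1311.2477v2,
  proof of Thm. 1, display (2.9), and Lemma 5 (key `Sbierski2015`).
* J. Ralston, *Gaussian beams and the propagation of singularities*, MAA Stud. Math. 23 (1982)
  206–248, §2 (key `Ralston1982`).
-/

noncomputable section

open Filter Set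
open scoped Topology ContDiff

namespace Literature.Geometry.Lorentzian

namespace KerrSchild

/-! ### Coordinate derivatives, complex symbol and complexified operator -/

/-- The coordinate partial derivative `∂_μ u (x)` of a complex-valued function on the chart `E4`
(real Fréchet derivative along `∂_μ = E4.basisVector μ`). [folklore] -/
def dC (u : E4 → ℂ) (x : E4) (μ : Fin 4) : ℂ := fderiv ℝ u x (E4.basisVector μ)

/-- Unfolding lemma for `KerrSchild.dC`. [folklore] -/
theorem dC_apply (u : E4 → ℂ) (x : E4) (μ : Fin 4) :
    dC u x μ = fderiv ℝ u x (E4.basisVector μ) := rfl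

/-- The complex-bilinear principal symbol (carré du champ) of a real coefficient field on component
covectors: `s_G(ζ, ξ)(x) = ∑_{μν} G^{μν}(x) ζ_μ ξ_ν`, i.e. `g⁻¹(dφ, dψ) = "dφ · dψ"` of Sbierski's
(2.9) extended bilinearly to complex differentials. [cite: Sbierski2015, arXiv (2.9)] -/
def symbolC (G : E4 → Fin 4 → Fin 4 → ℝ) (x : E4) (ζ ξ : Fin 4 → ℂ) : ℂ :=
  ∑ μ, ∑ ν, (G x μ ν : ℂ) * ζ μ * ξ ν

/-- Unfolding lemma for `KerrSchild.symbolC`. [folklore] -/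
theorem symbolC_apply (G : E4 → Fin 4 → Fin 4 → ℝ) (x : E4) (ζ ξ : Fin 4 → ℂ) :
    symbolC G x ζ ξ = ∑ μ, ∑ ν, (G x μ ν : ℂ) * ζ μ * ξ ν := rfl

/-- For a symmetric coefficient field the symbol is symmetric. [folklore] -/
theorem symbolC_comm {G : E4 → Fin 4 → Fin 4 → ℝ} {x : E4} (hG : ∀ μ ν, G x μ ν = G x ν μ)
    (ζ ξ : Fin 4 → ℂ) : symbolC G x ζ ξ = symbolC G x ξ ζ := by
  unfold symbolC
  rw [Finset.sum_comm]
  refine Finset.sum_congr rfl fun μ _ ↦ Finset.sum_congr rfl fun ν _ ↦ ?_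
  rw [hG ν μ]
  ring

/-- The **complexified divergence-form wave operator** of a real coefficient field on complex
functions: `(□_G u)(x) = ∑_μ ∂_μ (∑_ν G^{μν} ∂_ν u)(x)`, the operator `KerrSchild.waveOperator`
applied to real and imaginary parts (`re_waveOperatorC`, `im_waveOperatorC`).
[cite: Sbierski2015, arXiv (2.9)] -/
def waveOperatorC (G : E4 → Fin 4 → Fin 4 → ℝ) (u : E4 → ℂ) (x : E4) : ℂ :=
  ∑ μ, fderiv ℝ (fun y ↦ ∑ ν, (G y μ ν : ℂ) * dC u y ν) x (E4.basisVector μ)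

/-- Unfolding lemma for `KerrSchild.waveOperatorC`. [folklore] -/
theorem waveOperatorC_apply (G : E4 → Fin 4 → Fin 4 → ℝ) (u : E4 → ℂ) (x : E4) :
    waveOperatorC G u x =
      ∑ μ, fderiv ℝ (fun y ↦ ∑ ν, (G y μ ν : ℂ) * dC u y ν) x (E4.basisVector μ) := rfl

/-! ### Real and imaginary parts -/

/-- `∂_μ (re u) = re (∂_μ u)` at a point of differentiability. [folklore] -/
theorem fderiv_re_apply {u : E4 → ℂ} {y : E4} (hu : DifferentiableAt ℝ u y) (v : E4) :
    fderiv ℝ (fun z ↦ (u z).re) y v = (fderiv ℝ u y v).re := by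
  have h : HasFDerivAt (fun z ↦ (u z).re) (Complex.reCLM.comp (fderiv ℝ u y)) y :=
    Complex.reCLM.hasFDerivAt.comp y hu.hasFDerivAt
  rw [h.fderiv]
  rfl

/-- `∂_μ (im u) = im (∂_μ u)` at a point of differentiability. [folklore] -/
theorem fderiv_im_apply {u : E4 → ℂ} {y : E4} (hu : DifferentiableAt ℝ u y) (v : E4) :
    fderiv ℝ (fun z ↦ (u z).im) y v = (fderiv ℝ u y v).im := by
  have h : HasFDerivAt (fun z ↦ (u z).im) (Complex.imCLM.comp (fderiv ℝ u y)) y :=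
    Complex.imCLM.hasFDerivAt.comp y hu.hasFDerivAt
  rw [h.fderiv]
  rfl

/-- `∂_μ (↑f) = ↑(∂_μ f)` for a real function coerced to `ℂ` (at every point: if `f` is not
differentiable at `y`, neither is `↑f`, and both sides vanish). [folklore] -/
theorem fderiv_ofReal_apply (f : E4 → ℝ) (y : E4) (v : E4) :
    fderiv ℝ (fun z ↦ (f z : ℂ)) y v = (fderiv ℝ f y v : ℂ) := by
  by_cases hf : DifferentiableAt ℝ f y
  · have h : HasFDerivAt (fun z ↦ (f z : ℂ)) (Complex.ofRealCLM.comp (fderiv ℝ f y)) y :=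
      Complex.ofRealCLM.hasFDerivAt.comp y hf.hasFDerivAt
    rw [h.fderiv]
    rfl
  · have hf' : ¬ DifferentiableAt ℝ (fun z ↦ (f z : ℂ)) y := by
      intro h
      apply hf
      have h2 : DifferentiableAt ℝ (fun z ↦ ((f z : ℂ)).re) y := Complex.reCLM.differentiableAt.comp y h
      simpa using h2
    rw [fderiv_zero_of_not_differentiableAt hf, fderiv_zero_of_not_differentiableAt hf']
    simp

/-- A `C²` function is differentiable on a neighbourhood. [folklore] -/
theorem eventually_differentiableAt_of_contDiffAt {F : Type*} [NormedAddCommGroup F]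
    [NormedSpace ℝ F] {u : E4 → F} {x : E4} (hu : ContDiffAt ℝ 2 u x) :
    ∀ᶠ y in 𝓝 x, DifferentiableAt ℝ u y :=
  (hu.eventually (by simp)).mono fun _ hy ↦ hy.differentiableAt (by simp)

/-- The coordinate derivative `y ↦ ∂_ν u (y)` of a `C²` function is differentiable at the point.
[folklore] -/
theorem differentiableAt_dC {u : E4 → ℂ} {x : E4} (hu : ContDiffAt ℝ 2 u x) (ν : Fin 4) :
    DifferentiableAt ℝ (fun y ↦ dC u y ν) x := by
  have h2 : DifferentiableAt ℝ (fderiv ℝ u) x :=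
    (hu.fderiv_right (m := 1) le_rfl).differentiableAt one_ne_zero
  exact h2.clm_apply (differentiableAt_const _)

/-- The inner function `y ↦ ∑_ν G^{μν}(y) ∂_ν u(y)` of the complexified operator is differentiable
at a point where `G` is differentiable and `u ∈ C²`. [folklore] -/
theorem differentiableAt_inner {G : E4 → Fin 4 → Fin 4 → ℝ} {u : E4 → ℂ} {x : E4}
    (hG : ∀ μ ν, DifferentiableAt ℝ (fun y ↦ G y μ ν) x) (hu : ContDiffAt ℝ 2 u x) (μ : Fin 4) :
    DifferentiableAt ℝ (fun y ↦ ∑ ν, (G y μ ν : ℂ) * dC u y ν) x :=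
  DifferentiableAt.fun_sum fun ν _ ↦
    (Complex.ofRealCLM.differentiableAt.comp x (hG μ ν)).mul (differentiableAt_dC hu ν)

/-- **Real part of the complexified operator**: `re (□_G u)(x) = □_G (re u)(x)` for `G`
differentiable at `x` and `u ∈ C²` at `x`. [folklore] -/
theorem re_waveOperatorC {G : E4 → Fin 4 → Fin 4 → ℝ} {u : E4 → ℂ} {x : E4}
    (hG : ∀ μ ν, DifferentiableAt ℝ (fun y ↦ G y μ ν) x) (hu : ContDiffAt ℝ 2 u x) :
    (waveOperatorC G u x).re = waveOperator G (fun y ↦ (u y).re) x := by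
  have hu1 := eventually_differentiableAt_of_contDiffAt hu
  have hinner : ∀ μ, (fun y ↦ ∑ ν, G y μ ν * fderiv ℝ (fun z ↦ (u z).re) y (E4.basisVector ν))
      =ᶠ[𝓝 x] fun y ↦ (∑ ν, (G y μ ν : ℂ) * dC u y ν).re := by
    intro μ
    filter_upwards [hu1] with y hy
    simp only [Complex.re_sum, Complex.re_ofReal_mul, dC, fderiv_re_apply hy]
  unfold waveOperator waveOperatorC
  rw [Complex.re_sum]
  refine Finset.sum_congr rfl fun μ _ ↦ ?_
  rw [(hinner μ).fderiv_eq, fderiv_re_apply (differentiableAt_inner hG hu μ)]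

/-- **Imaginary part of the complexified operator**: `im (□_G u)(x) = □_G (im u)(x)` for `G`
differentiable at `x` and `u ∈ C²` at `x`. [folklore] -/
theorem im_waveOperatorC {G : E4 → Fin 4 → Fin 4 → ℝ} {u : E4 → ℂ} {x : E4}
    (hG : ∀ μ ν, DifferentiableAt ℝ (fun y ↦ G y μ ν) x) (hu : ContDiffAt ℝ 2 u x) :
    (waveOperatorC G u x).im = waveOperator G (fun y ↦ (u y).im) x := by
  have hu1 := eventually_differentiableAt_of_contDiffAt hu
  have hinner : ∀ μ, (fun y ↦ ∑ ν, G y μ ν * fderiv ℝ (fun z ↦ (u z).im) y (E4.basisVector ν))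
      =ᶠ[𝓝 x] fun y ↦ (∑ ν, (G y μ ν : ℂ) * dC u y ν).im := by
    intro μ
    filter_upwards [hu1] with y hy
    simp only [Complex.im_sum, Complex.im_ofReal_mul, dC, fderiv_im_apply hy]
  unfold waveOperator waveOperatorC
  rw [Complex.im_sum]
  refine Finset.sum_congr rfl fun μ _ ↦ ?_
  rw [(hinner μ).fderiv_eq, fderiv_im_apply (differentiableAt_inner hG hu μ)]

/-- **The complexified operator extends the real one**: `□_G (↑f) = ↑(□_G f)` at every point.
[folklore] -/
theorem waveOperatorC_ofReal (G : E4 → Fin 4 → Fin 4 → ℝ) (f : E4 → ℝ) (x : E4) :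
    waveOperatorC G (fun y ↦ (f y : ℂ)) x = (waveOperator G f x : ℂ) := by
  unfold waveOperator waveOperatorC
  rw [Complex.ofReal_sum]
  refine Finset.sum_congr rfl fun μ _ ↦ ?_
  have hinner : (fun y ↦ ∑ ν, (G y μ ν : ℂ) * dC (fun z ↦ (f z : ℂ)) y ν) =
      fun y ↦ ((∑ ν, G y μ ν * fderiv ℝ f y (E4.basisVector ν) : ℝ) : ℂ) := by
    funext y
    simp only [dC, fderiv_ofReal_apply, Complex.ofReal_sum, Complex.ofReal_mul]
  rw [hinner, fderiv_ofReal_apply]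

/-! ### The WKB identity -/

/-- **First derivatives of an amplitude–phase function**: at a point where `a` and `φ` are
differentiable, `∂_ν (a e^{κφ}) = e^{κφ} (∂_ν a + κ a ∂_ν φ)`. [cite: Sbierski2015, arXiv (2.9)] -/
theorem hasFDerivAt_mul_cexp {a φ : E4 → ℂ} {y : E4} (κ : ℂ) (ha : DifferentiableAt ℝ a y)
    (hφ : DifferentiableAt ℝ φ y) :
    HasFDerivAt (fun z ↦ a z * Complex.exp (κ * φ z))
      (a y • (Complex.exp (κ * φ y) • (κ • fderiv ℝ φ y)) +
        Complex.exp (κ * φ y) • fderiv ℝ a y) y :=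
  ha.hasFDerivAt.mul (hφ.hasFDerivAt.const_mul κ).cexp

/-- `∂_ν (a e^{κφ}) = e^{κφ} (∂_ν a + κ a ∂_ν φ)` in components. [cite: Sbierski2015, arXiv (2.9)] -/
theorem dC_mul_cexp {a φ : E4 → ℂ} {y : E4} (κ : ℂ) (ha : DifferentiableAt ℝ a y)
    (hφ : DifferentiableAt ℝ φ y) (ν : Fin 4) :
    dC (fun z ↦ a z * Complex.exp (κ * φ z)) y ν =
      Complex.exp (κ * φ y) * (dC a y ν + κ * a y * dC φ y ν) := by
  rw [dC, (hasFDerivAt_mul_cexp κ ha hφ).fderiv]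
  simp only [dC, FunLike.coe_add, Pi.add_apply, FunLike.coe_smul,
    Pi.smul_apply, smul_eq_mul]
  ring

/-- The exponential factor `e^{κφ}` has derivative `e^{κφ} κ ∂_μ φ`. [folklore] -/
theorem dC_cexp {φ : E4 → ℂ} {y : E4} (κ : ℂ) (hφ : DifferentiableAt ℝ φ y) (μ : Fin 4) :
    dC (fun z ↦ Complex.exp (κ * φ z)) y μ = Complex.exp (κ * φ y) * (κ * dC φ y μ) := by
  rw [dC, (hφ.hasFDerivAt.const_mul κ).cexp.fderiv]
  simp only [dC, FunLike.coe_smul, Pi.smul_apply, smul_eq_mul]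

/-- **The WKB identity for the divergence-form wave operator** (Sbierski's (2.9), for an arbitrary
complex constant `κ` in place of `iλ`, and without any symmetry assumption on `G`): if the
coefficients `G^{μν}` are differentiable at `x` and `a, φ ∈ C²` at `x`, then
`□_G (a e^{κφ})(x) = e^{κφ(x)} ( κ² a s(dφ, dφ) + κ (s(dφ, da) + s(da, dφ) + a □_G φ) + □_G a )(x)`
with `s = symbolC G x` on the component differentials `dC`. Proof: near `x`,
`∑_ν G^{μν} ∂_ν(a e^{κφ}) = e^{κφ} (L_μ + κ a K_μ)` with `L_μ = ∑_ν G^{μν} ∂_ν a`,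
`K_μ = ∑_ν G^{μν} ∂_ν φ`, and `∑_μ ∂_μ L_μ = □_G a`, `∑_μ ∂_μ K_μ = □_G φ`.
[cite: Sbierski2015, arXiv (2.9)] -/
theorem waveOperatorC_mul_cexp {G : E4 → Fin 4 → Fin 4 → ℝ} {a φ : E4 → ℂ} {x : E4} (κ : ℂ)
    (hG : ∀ μ ν, DifferentiableAt ℝ (fun y ↦ G y μ ν) x) (ha : ContDiffAt ℝ 2 a x)
    (hφ : ContDiffAt ℝ 2 φ x) :
    waveOperatorC G (fun y ↦ a y * Complex.exp (κ * φ y)) x =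
      Complex.exp (κ * φ x) *
        (κ ^ 2 * a x * symbolC G x (dC φ x) (dC φ x) +
          κ * (symbolC G x (dC φ x) (dC a x) + symbolC G x (dC a x) (dC φ x) +
            a x * waveOperatorC G φ x) +
          waveOperatorC G a x) := by
  -- notation
  set e : E4 → ℂ := fun y ↦ Complex.exp (κ * φ y) with he
  set K : Fin 4 → E4 → ℂ := fun μ y ↦ ∑ ν, (G y μ ν : ℂ) * dC φ y ν with hK
  set L : Fin 4 → E4 → ℂ := fun μ y ↦ ∑ ν, (G y μ ν : ℂ) * dC a y ν with hL
  have ha1 : DifferentiableAt ℝ a x := ha.differentiableAt (by simp)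
  have hφ1 : DifferentiableAt ℝ φ x := hφ.differentiableAt (by simp)
  have hGc : ∀ μ ν, DifferentiableAt ℝ (fun y ↦ (G y μ ν : ℂ)) x :=
    fun μ ν ↦ Complex.ofRealCLM.differentiableAt.comp x (hG μ ν)
  have hKd : ∀ μ, DifferentiableAt ℝ (K μ) x := fun μ ↦ differentiableAt_inner hG hφ μ
  have hLd : ∀ μ, DifferentiableAt ℝ (L μ) x := fun μ ↦ differentiableAt_inner hG ha μ
  have hed : HasFDerivAt e (e x • (κ • fderiv ℝ φ x)) x := (hφ1.hasFDerivAt.const_mul κ).cexp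
  -- Step 1: the inner functions near `x`
  have hnear : ∀ᶠ y in 𝓝 x, DifferentiableAt ℝ a y ∧ DifferentiableAt ℝ φ y :=
    (eventually_differentiableAt_of_contDiffAt ha).and (eventually_differentiableAt_of_contDiffAt hφ)
  have hinner : ∀ μ, (fun y ↦ ∑ ν, (G y μ ν : ℂ) * dC (fun z ↦ a z * Complex.exp (κ * φ z)) y ν)
      =ᶠ[𝓝 x] fun y ↦ e y * (L μ y + κ * (a y * K μ y)) := by
    intro μ
    filter_upwards [hnear] with y hy
    have hterm : ∀ ν, (G y μ ν : ℂ) * dC (fun z ↦ a z * Complex.exp (κ * φ z)) y ν =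
        e y * ((G y μ ν : ℂ) * dC a y ν) + e y * (κ * a y) * ((G y μ ν : ℂ) * dC φ y ν) := by
      intro ν
      rw [dC_mul_cexp κ hy.1 hy.2 ν]
      ring
    simp only [hterm, Finset.sum_add_distrib, ← Finset.mul_sum, hL, hK]
    ring
  -- Step 2: derivative of `e (L_μ + κ a K_μ)` at `x`
  have hH : ∀ μ, HasFDerivAt (fun y ↦ L μ y + κ * (a y * K μ y))
      (fderiv ℝ (L μ) x + κ • (a x • fderiv ℝ (K μ) x + K μ x • fderiv ℝ a x)) x :=
    fun μ ↦ (hLd μ).hasFDerivAt.add ((ha1.hasFDerivAt.mul (hKd μ).hasFDerivAt).const_mul κ)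
  have hprod : ∀ μ, HasFDerivAt (fun y ↦ e y * (L μ y + κ * (a y * K μ y)))
      (e x • (fderiv ℝ (L μ) x + κ • (a x • fderiv ℝ (K μ) x + K μ x • fderiv ℝ a x)) +
        (L μ x + κ * (a x * K μ x)) • (e x • (κ • fderiv ℝ φ x))) x :=
    fun μ ↦ hed.mul (hH μ)
  have hterm : ∀ μ, fderiv ℝ (fun y ↦ ∑ ν, (G y μ ν : ℂ) *
      dC (fun z ↦ a z * Complex.exp (κ * φ z)) y ν) x (E4.basisVector μ) =
      e x * (fderiv ℝ (L μ) x (E4.basisVector μ) + κ * (a x * fderiv ℝ (K μ) x (E4.basisVector μ))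
        + κ * (K μ x * dC a x μ) + κ * (L μ x * dC φ x μ) + κ ^ 2 * (a x * (K μ x * dC φ x μ))) := by
    intro μ
    rw [(hinner μ).fderiv_eq, (hprod μ).fderiv]
    simp only [FunLike.coe_add, Pi.add_apply, FunLike.coe_smul,
      Pi.smul_apply, smul_eq_mul, dC]
    ring
  -- Step 3: sum over `μ` and identify the pieces
  have hwave : waveOperatorC G (fun y ↦ a y * Complex.exp (κ * φ y)) x =
      ∑ μ, fderiv ℝ (fun y ↦ ∑ ν, (G y μ ν : ℂ) *
        dC (fun z ↦ a z * Complex.exp (κ * φ z)) y ν) x (E4.basisVector μ) := rfl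
  have hPa : waveOperatorC G a x = ∑ μ, fderiv ℝ (L μ) x (E4.basisVector μ) := rfl
  have hPφ : waveOperatorC G φ x = ∑ μ, fderiv ℝ (K μ) x (E4.basisVector μ) := rfl
  have hs1 : symbolC G x (dC a x) (dC φ x) = ∑ μ, K μ x * dC a x μ := by
    unfold symbolC
    refine Finset.sum_congr rfl fun μ _ ↦ ?_
    rw [hK, Finset.sum_mul]
    exact Finset.sum_congr rfl fun ν _ ↦ by ring
  have hs2 : symbolC G x (dC φ x) (dC a x) = ∑ μ, L μ x * dC φ x μ := by
    unfold symbolC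
    refine Finset.sum_congr rfl fun μ _ ↦ ?_
    rw [hL, Finset.sum_mul]
    exact Finset.sum_congr rfl fun ν _ ↦ by ring
  have hs3 : symbolC G x (dC φ x) (dC φ x) = ∑ μ, K μ x * dC φ x μ := by
    unfold symbolC
    refine Finset.sum_congr rfl fun μ _ ↦ ?_
    rw [hK, Finset.sum_mul]
    exact Finset.sum_congr rfl fun ν _ ↦ by ring
  rw [hwave, Finset.sum_congr rfl fun μ _ ↦ hterm μ, ← Finset.mul_sum, hPa, hPφ, hs1, hs2, hs3]
  simp only [Finset.sum_add_distrib, ← Finset.mul_sum]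
  ring

/-- **The WKB identity, symmetric coefficients** (the printed form of Sbierski's (2.9) with
`2 g⁻¹(dφ, da)`): for `G` symmetric at `x`,
`□_G (a e^{κφ})(x) = e^{κφ(x)} ( κ² a s(dφ, dφ) + κ (2 s(dφ, da) + a □_G φ) + □_G a )(x)`.
[cite: Sbierski2015, arXiv (2.9)] -/
theorem waveOperatorC_mul_cexp_of_symm {G : E4 → Fin 4 → Fin 4 → ℝ} {a φ : E4 → ℂ} {x : E4}
    (κ : ℂ) (hG : ∀ μ ν, DifferentiableAt ℝ (fun y ↦ G y μ ν) x)
    (hGs : ∀ μ ν, G x μ ν = G x ν μ) (ha : ContDiffAt ℝ 2 a x) (hφ : ContDiffAt ℝ 2 φ x) :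
    waveOperatorC G (fun y ↦ a y * Complex.exp (κ * φ y)) x =
      Complex.exp (κ * φ x) *
        (κ ^ 2 * a x * symbolC G x (dC φ x) (dC φ x) +
          κ * (2 * symbolC G x (dC φ x) (dC a x) + a x * waveOperatorC G φ x) +
          waveOperatorC G a x) := by
  rw [waveOperatorC_mul_cexp κ hG ha hφ, symbolC_comm hGs (dC a x) (dC φ x)]
  ring

/-! ### Pointwise bounds for `κ = iλ` -/

/-- `|e^{iλφ}| = e^{−λ Im φ}`. [cite: Sbierski2015, arXiv proof of Lemma 5] -/
theorem norm_cexp_I_mul (lam : ℝ) (z : ℂ) :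
    ‖Complex.exp (Complex.I * lam * z)‖ = Real.exp (-(lam * z.im)) := by
  rw [Complex.norm_exp]
  congr 1
  simp [Complex.mul_re, Complex.mul_im]

/-- `(iλ)² = −λ²`. [folklore] -/
theorem I_mul_sq (lam : ℝ) : (Complex.I * lam) ^ 2 = -((lam : ℂ) ^ 2) := by
  rw [mul_pow, Complex.I_sq]
  ring

/-- **Pointwise bound for the wave operator on a beam** `u = a e^{iλφ}` (symmetric `G`
differentiable at `x`; `a, φ ∈ C²` at `x`):
`|□_G (a e^{iλφ})(x)| ≤ e^{−λ Im φ(x)} (λ² |a| |s(dφ, dφ)| + |λ| |2 s(dφ, da) + a □_G φ| + |□_G a|)(x)` —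
the three terms of Sbierski's (2.9) whose vanishing orders along `γ` (eikonal to second order,
transport to zeroth order) feed the Gaussian damping lemma. [cite: Sbierski2015, arXiv (2.9) and Lemma 5] -/
theorem norm_waveOperatorC_beam_le {G : E4 → Fin 4 → Fin 4 → ℝ} {a φ : E4 → ℂ} {x : E4}
    (lam : ℝ) (hG : ∀ μ ν, DifferentiableAt ℝ (fun y ↦ G y μ ν) x)
    (hGs : ∀ μ ν, G x μ ν = G x ν μ) (ha : ContDiffAt ℝ 2 a x) (hφ : ContDiffAt ℝ 2 φ x) :
    ‖waveOperatorC G (fun y ↦ a y * Complex.exp (Complex.I * lam * φ y)) x‖ ≤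
      Real.exp (-(lam * (φ x).im)) *
        (lam ^ 2 * ‖a x‖ * ‖symbolC G x (dC φ x) (dC φ x)‖ +
          |lam| * ‖2 * symbolC G x (dC φ x) (dC a x) + a x * waveOperatorC G φ x‖ +
          ‖waveOperatorC G a x‖) := by
  rw [waveOperatorC_mul_cexp_of_symm (Complex.I * lam) hG hGs ha hφ, norm_mul, norm_cexp_I_mul]
  refine mul_le_mul_of_nonneg_left ?_ (Real.exp_nonneg _)
  refine (norm_add₃_le).trans ?_
  rw [I_mul_sq, norm_mul, norm_mul, norm_neg, norm_pow, Complex.norm_real, Real.norm_eq_abs,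
    sq_abs, norm_mul, norm_mul, Complex.norm_I, one_mul, Complex.norm_real, Real.norm_eq_abs]

/-- A beam `a e^{iλφ}` is `C²` at a point where `a` and `φ` are. [folklore] -/
theorem contDiffAt_beam {a φ : E4 → ℂ} {x : E4} (lam : ℝ) (ha : ContDiffAt ℝ 2 a x)
    (hφ : ContDiffAt ℝ 2 φ x) :
    ContDiffAt ℝ 2 (fun y ↦ a y * Complex.exp (Complex.I * lam * φ y)) x :=
  ha.mul (contDiffAt_const.mul hφ).cexp

/-- **Pointwise bound for the real wave operator on the real part of a beam**:
`|□_G Re(a e^{iλφ})(x)| ≤ e^{−λ Im φ(x)} (λ² |a| |s(dφ, dφ)| + |λ| |2 s(dφ, da) + a □_G φ| + |□_G a|)(x)`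
(third remark after Sbierski's Thm. 2.1: real-valued beams). [cite: Sbierski2015, arXiv (2.9), Lemma 5 and Remark 3] -/
theorem abs_waveOperator_re_beam_le {G : E4 → Fin 4 → Fin 4 → ℝ} {a φ : E4 → ℂ} {x : E4}
    (lam : ℝ) (hG : ∀ μ ν, DifferentiableAt ℝ (fun y ↦ G y μ ν) x)
    (hGs : ∀ μ ν, G x μ ν = G x ν μ) (ha : ContDiffAt ℝ 2 a x) (hφ : ContDiffAt ℝ 2 φ x) :
    |waveOperator G (fun y ↦ (a y * Complex.exp (Complex.I * lam * φ y)).re) x| ≤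
      Real.exp (-(lam * (φ x).im)) *
        (lam ^ 2 * ‖a x‖ * ‖symbolC G x (dC φ x) (dC φ x)‖ +
          |lam| * ‖2 * symbolC G x (dC φ x) (dC a x) + a x * waveOperatorC G φ x‖ +
          ‖waveOperatorC G a x‖) := by
  rw [← re_waveOperatorC hG (contDiffAt_beam lam ha hφ)]
  exact (Complex.abs_re_le_norm _).trans (norm_waveOperatorC_beam_le lam hG hGs ha hφ)

/-- The same bound for the imaginary part of a beam. [cite: Sbierski2015, arXiv (2.9), Lemma 5 and Remark 3] -/
theorem abs_waveOperator_im_beam_le {G : E4 → Fin 4 → Fin 4 → ℝ} {a φ : E4 → ℂ} {x : E4}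
    (lam : ℝ) (hG : ∀ μ ν, DifferentiableAt ℝ (fun y ↦ G y μ ν) x)
    (hGs : ∀ μ ν, G x μ ν = G x ν μ) (ha : ContDiffAt ℝ 2 a x) (hφ : ContDiffAt ℝ 2 φ x) :
    |waveOperator G (fun y ↦ (a y * Complex.exp (Complex.I * lam * φ y)).im) x| ≤
      Real.exp (-(lam * (φ x).im)) *
        (lam ^ 2 * ‖a x‖ * ‖symbolC G x (dC φ x) (dC φ x)‖ +
          |lam| * ‖2 * symbolC G x (dC φ x) (dC a x) + a x * waveOperatorC G φ x‖ +
          ‖waveOperatorC G a x‖) := by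
  rw [← im_waveOperatorC hG (contDiffAt_beam lam ha hφ)]
  exact (Complex.abs_im_le_norm _).trans (norm_waveOperatorC_beam_le lam hG hGs ha hφ)

/-! ### Quadratic forms of the gradient of the real part of a beam (energy densities)

The energy density of a real wave `ψ` through a leaf is a real quadratic form
`Q_T(dψ) = ∑_{μν} T^{μν} ∂_μψ ∂_νψ` of its gradient (`T^{μν} = V^μ W^ν − ½ g(V, W) g^{μν}` for the
current `J^V` through a leaf with normal `W`; `KerrSchild.multiplierCurrent`,
`Kerr.leafFluxDensity_eq_ofReal`). For the real part of a beam `u = A e^{iλφ}`, with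
`du = e^{iλφ} w`, `w = dA + iλ A dφ`, polarisation gives
`Q_T(d Re u) = ½ e^{−2λ Im φ} Re s_T(w, w̄) + ½ Re (e^{2iλφ} s_T(w, w))`: a non-oscillatory part,
whose leading term `½ λ² |A|² e^{−2λ Im φ} (Q_T(d Re φ) + Q_T(d Im φ))` is Sbierski's
`λ² |a|² (Nφ₁ · nφ₁ + Nφ₂ · nφ₂ − ½ g(N, n)(dφ₁·dφ₁ + dφ₂·dφ₂)) e^{−2λ Im φ}` (§4, proof of the
theorem, first display) up to the factor `½` of the real part, and an oscillatory part with phase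
`2λ Re φ` (third remark after the theorem: "we have to deal with more terms"), to be integrated by
parts leafwise (`Literature/Analysis/Asymptotics/DirectionalNonStationaryPhase.lean`). -/

/-- Polarisation of a product of real parts: `Re a · Re b = ½ Re(ab) + ½ Re(a b̄)`. [folklore] -/
theorem re_mul_re_eq (a b : ℂ) :
    a.re * b.re = 2⁻¹ * (a * b).re + 2⁻¹ * (a * (starRingEnd ℂ) b).re := by
  simp only [Complex.mul_re, Complex.conj_re, Complex.conj_im]
  ring

/-- **Polarisation of a real quadratic form on the real part of a complex covector**:
`∑ T^{μν} Re ζ_μ Re ζ_ν = ½ Re s_T(ζ, ζ̄) + ½ Re s_T(ζ, ζ)` (no symmetry of `T` needed).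
[folklore] -/
theorem sum_mul_re_mul_re (T : E4 → Fin 4 → Fin 4 → ℝ) (x : E4) (ζ : Fin 4 → ℂ) :
    ∑ μ, ∑ ν, T x μ ν * (ζ μ).re * (ζ ν).re =
      2⁻¹ * (symbolC T x ζ (star ζ)).re + 2⁻¹ * (symbolC T x ζ ζ).re := by
  have key : ∀ μ ν, T x μ ν * (ζ μ).re * (ζ ν).re =
      2⁻¹ * ((T x μ ν : ℂ) * ζ μ * star ζ ν).re + 2⁻¹ * ((T x μ ν : ℂ) * ζ μ * ζ ν).re := by
    intro μ ν
    rw [Pi.star_apply, Complex.star_def, mul_assoc (T x μ ν : ℂ), mul_assoc (T x μ ν : ℂ),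
      Complex.re_ofReal_mul, Complex.re_ofReal_mul, mul_assoc, re_mul_re_eq]
    ring
  calc ∑ μ, ∑ ν, T x μ ν * (ζ μ).re * (ζ ν).re
      = ∑ μ, ∑ ν, (2⁻¹ * ((T x μ ν : ℂ) * ζ μ * star ζ ν).re +
          2⁻¹ * ((T x μ ν : ℂ) * ζ μ * ζ ν).re) :=
        Finset.sum_congr rfl fun μ _ ↦ Finset.sum_congr rfl fun ν _ ↦ key μ ν
    _ = 2⁻¹ * ∑ μ, ∑ ν, ((T x μ ν : ℂ) * ζ μ * star ζ ν).re +
          2⁻¹ * ∑ μ, ∑ ν, ((T x μ ν : ℂ) * ζ μ * ζ ν).re := by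
        simp only [Finset.sum_add_distrib, Finset.mul_sum]
    _ = 2⁻¹ * (symbolC T x ζ (star ζ)).re + 2⁻¹ * (symbolC T x ζ ζ).re := by
        simp only [symbolC, Complex.re_sum]

/-- **The real part of `s_T(ζ, ζ̄)`** is the sum of the quadratic forms of the real and imaginary
parts: `Re s_T(ζ, ζ̄) = ∑ T^{μν} (Re ζ_μ Re ζ_ν + Im ζ_μ Im ζ_ν)` (no symmetry needed) — for
`ζ = dφ` this is Sbierski's `Nφ₁ nφ₁ + Nφ₂ nφ₂`-structure of the leading term of the energy.
[cite: Sbierski2015, §4 (proof of the theorem, first display)] -/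
theorem re_symbolC_self_star (T : E4 → Fin 4 → Fin 4 → ℝ) (x : E4) (ζ : Fin 4 → ℂ) :
    (symbolC T x ζ (star ζ)).re =
      ∑ μ, ∑ ν, T x μ ν * ((ζ μ).re * (ζ ν).re + (ζ μ).im * (ζ ν).im) := by
  simp only [symbolC, Complex.re_sum]
  refine Finset.sum_congr rfl fun μ _ ↦ Finset.sum_congr rfl fun ν _ ↦ ?_
  rw [Pi.star_apply, Complex.star_def, mul_assoc, Complex.re_ofReal_mul]
  simp only [Complex.mul_re, Complex.conj_re, Complex.conj_im]
  ring

/-- **A real quadratic form of the gradient of `Re u`** in terms of the complex gradient: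
`∑ T^{μν} ∂_μ(Re u) ∂_ν(Re u) = ½ Re s_T(du, dū) + ½ Re s_T(du, du)` at a point of
differentiability. [folklore] -/
theorem sum_mul_fderiv_re (T : E4 → Fin 4 → Fin 4 → ℝ) {u : E4 → ℂ} {x : E4}
    (hu : DifferentiableAt ℝ u x) :
    ∑ μ, ∑ ν, T x μ ν * fderiv ℝ (fun y ↦ (u y).re) x (E4.basisVector μ) *
        fderiv ℝ (fun y ↦ (u y).re) x (E4.basisVector ν) =
      2⁻¹ * (symbolC T x (dC u x) (star (dC u x))).re +
        2⁻¹ * (symbolC T x (dC u x) (dC u x)).re := by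
  simp only [fderiv_re_apply hu]
  exact sum_mul_re_mul_re T x (dC u x)

/-- The symbol is homogeneous in the first slot. [folklore] -/
theorem symbolC_smul_left (T : E4 → Fin 4 → Fin 4 → ℝ) (x : E4) (c : ℂ) (ζ ξ : Fin 4 → ℂ) :
    symbolC T x (c • ζ) ξ = c * symbolC T x ζ ξ := by
  unfold symbolC
  simp only [Pi.smul_apply, smul_eq_mul, Finset.mul_sum]
  exact Finset.sum_congr rfl fun μ _ ↦ Finset.sum_congr rfl fun ν _ ↦ by ring

/-- The symbol is homogeneous in the second slot. [folklore] -/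
theorem symbolC_smul_right (T : E4 → Fin 4 → Fin 4 → ℝ) (x : E4) (d : ℂ) (ζ ξ : Fin 4 → ℂ) :
    symbolC T x ζ (d • ξ) = d * symbolC T x ζ ξ := by
  unfold symbolC
  simp only [Pi.smul_apply, smul_eq_mul, Finset.mul_sum]
  exact Finset.sum_congr rfl fun μ _ ↦ Finset.sum_congr rfl fun ν _ ↦ by ring

/-- The symbol is additive in the first slot. [folklore] -/
theorem symbolC_add_left (T : E4 → Fin 4 → Fin 4 → ℝ) (x : E4) (ζ ζ' ξ : Fin 4 → ℂ) :
    symbolC T x (ζ + ζ') ξ = symbolC T x ζ ξ + symbolC T x ζ' ξ := by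
  unfold symbolC
  simp only [Pi.add_apply, ← Finset.sum_add_distrib]
  exact Finset.sum_congr rfl fun μ _ ↦ Finset.sum_congr rfl fun ν _ ↦ by ring

/-- The symbol is additive in the second slot. [folklore] -/
theorem symbolC_add_right (T : E4 → Fin 4 → Fin 4 → ℝ) (x : E4) (ζ ξ ξ' : Fin 4 → ℂ) :
    symbolC T x ζ (ξ + ξ') = symbolC T x ζ ξ + symbolC T x ζ ξ' := by
  unfold symbolC
  simp only [Pi.add_apply, ← Finset.sum_add_distrib]
  exact Finset.sum_congr rfl fun μ _ ↦ Finset.sum_congr rfl fun ν _ ↦ by ring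

/-- **The gradient of a beam** as a covector: `d(A e^{iλφ}) = e^{iλφ} (dA + iλ A dφ)` at a point
of differentiability. [cite: Sbierski2015, arXiv (2.9)] -/
theorem dC_beam {A φ : E4 → ℂ} {x : E4} (lam : ℝ) (hA : DifferentiableAt ℝ A x)
    (hφ : DifferentiableAt ℝ φ x) :
    dC (fun y ↦ A y * Complex.exp (Complex.I * lam * φ y)) x =
      Complex.exp (Complex.I * lam * φ x) • (dC A x + (Complex.I * lam * A x) • dC φ x) := by
  funext ν
  rw [dC_mul_cexp (Complex.I * lam) hA hφ ν]
  simp only [Pi.smul_apply, Pi.add_apply, smul_eq_mul]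

/-- `e^{iλφ} · conj(e^{iλφ}) = e^{−2λ Im φ}`. [folklore] -/
theorem cexp_mul_conj_cexp (lam : ℝ) (z : ℂ) :
    Complex.exp (Complex.I * lam * z) * (starRingEnd ℂ) (Complex.exp (Complex.I * lam * z)) =
      (Real.exp (-(2 * lam * z.im)) : ℂ) := by
  rw [Complex.mul_conj, Complex.normSq_eq_norm_sq, norm_cexp_I_mul, ← Real.exp_nat_mul]
  push_cast
  ring_nf

/-- `e^{iλφ} · e^{iλφ} = e^{2iλφ}`. [folklore] -/
theorem cexp_mul_cexp (lam : ℝ) (z : ℂ) :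
    Complex.exp (Complex.I * lam * z) * Complex.exp (Complex.I * lam * z) =
      Complex.exp (2 * (Complex.I * lam * z)) := by
  rw [← Complex.exp_add, two_mul]

/-- **The energy density of the real part of a beam, polarised.** For any real coefficient field
`T` and `A, φ` differentiable at `x`, with `w = dA + iλ A dφ` (components `dC`):
`∑ T^{μν} ∂_μ Re(A e^{iλφ}) ∂_ν Re(A e^{iλφ}) = ½ e^{−2λ Im φ} Re s_T(w, w̄) + ½ Re (e^{2iλφ} s_T(w, w))`
at `x` — the non-oscillatory part and the oscillatory part (phase `2λ Re φ`) of the energy density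
of a real-valued Gaussian beam. [cite: Sbierski2015, §4 (proof of the theorem; third remark)] -/
theorem sum_mul_fderiv_re_beam (T : E4 → Fin 4 → Fin 4 → ℝ) {A φ : E4 → ℂ} {x : E4} (lam : ℝ)
    (hA : DifferentiableAt ℝ A x) (hφ : DifferentiableAt ℝ φ x) :
    ∑ μ, ∑ ν, T x μ ν *
        fderiv ℝ (fun y ↦ (A y * Complex.exp (Complex.I * lam * φ y)).re) x (E4.basisVector μ) *
        fderiv ℝ (fun y ↦ (A y * Complex.exp (Complex.I * lam * φ y)).re) x (E4.basisVector ν) =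
      2⁻¹ * Real.exp (-(2 * lam * (φ x).im)) *
          (symbolC T x (dC A x + (Complex.I * lam * A x) • dC φ x)
            (star (dC A x + (Complex.I * lam * A x) • dC φ x))).re +
        2⁻¹ * (Complex.exp (2 * (Complex.I * lam * φ x)) *
          symbolC T x (dC A x + (Complex.I * lam * A x) • dC φ x)
            (dC A x + (Complex.I * lam * A x) • dC φ x)).re := by
  have hu : DifferentiableAt ℝ (fun y ↦ A y * Complex.exp (Complex.I * lam * φ y)) x :=
    hA.mul (hφ.const_mul _).cexp
  rw [sum_mul_fderiv_re T hu, dC_beam lam hA hφ, star_smul, symbolC_smul_left, symbolC_smul_right,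
    symbolC_smul_left, symbolC_smul_right, Complex.star_def, ← mul_assoc, cexp_mul_conj_cexp,
    Complex.re_ofReal_mul, ← mul_assoc, ← mul_assoc (Complex.exp _), cexp_mul_cexp]

/-- **Expansion of the non-oscillatory part**: for `w = p + iλα q`,
`s_T(w, w̄) = λ² |α|² s_T(q, q̄) + iλ (α s_T(q, p̄) − ᾱ s_T(p, q̄)) + s_T(p, p̄)` — with `p = dA`,
`q = dφ`, `α = A` the orders `λ²` (leading: `λ² |A|² (Q_T(dφ₁) + Q_T(dφ₂))` by
`re_symbolC_self_star`), `λ` and `1` of the energy density of a beam.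
[cite: Sbierski2015, §4 (proof of the theorem, first display)] -/
theorem symbolC_beamCovector_star (T : E4 → Fin 4 → Fin 4 → ℝ) (x : E4) (lam : ℝ) (α : ℂ)
    (p q : Fin 4 → ℂ) :
    symbolC T x (p + (Complex.I * lam * α) • q) (star (p + (Complex.I * lam * α) • q)) =
      (lam : ℂ) ^ 2 * ((‖α‖ ^ 2 : ℝ) : ℂ) * symbolC T x q (star q) +
        Complex.I * lam *
          (α * symbolC T x q (star p) - (starRingEnd ℂ) α * symbolC T x p (star q)) +
        symbolC T x p (star p) := by
  have hα : α * (starRingEnd ℂ) α = ((‖α‖ ^ 2 : ℝ) : ℂ) := by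
    rw [Complex.mul_conj, Complex.normSq_eq_norm_sq]
  rw [star_add, star_smul, Complex.star_def]
  simp only [symbolC_add_left, symbolC_add_right, symbolC_smul_left, symbolC_smul_right, map_mul,
    Complex.conj_I, Complex.conj_ofReal]
  linear_combination (-((lam : ℂ) ^ 2 * (α * (starRingEnd ℂ) α) * symbolC T x q (star q))) *
      Complex.I_sq + ((lam : ℂ) ^ 2 * symbolC T x q (star q)) * hα

end KerrSchild

/-! ### On the Kerr chart -/

namespace Kerr

open KerrSchild

/-- **The d'Alembertian of the Kerr metric on the real part of an amplitude–phase function.** On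
`Kerr.region a r₀`, for `ψ = Re(A e^{κφ})` with `A, φ : E4 → ℂ` of class `C²` at `x`,
`□_{g_{M,a}} ψ (x) = Re[ e^{κφ} ( κ² A s(dφ, dφ) + κ (2 s(dφ, dA) + A □φ) + □A ) ](x)` with
`s = symbolC (Kerr.inverseMetric M a) x` and `□ = waveOperatorC (Kerr.inverseMetric M a)` — the
divergence form `Kerr.dalembertian_eq_divergence` (`|det g| = 1`), the symmetry and smoothness of
`g^{μν}` for `r > 0`, and the WKB identity. [cite: Sbierski2015, arXiv (2.9); KerrSchild1965, §2] -/
theorem dalembertian_re_beam [Facts] [SliceFacts] (M a r₀ : ℝ) {ψ : region a r₀ → ℝ}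
    {A φ : E4 → ℂ} (κ : ℂ) (hψ : ∀ y, ψ y = (A y * Complex.exp (κ * φ y)).re) (x : region a r₀)
    (hA : ContDiffAt ℝ 2 A x) (hφ : ContDiffAt ℝ 2 φ x) :
    (smoothMetric M a r₀).toPseudoRiemannianMetric.dalembertian ψ x =
      (Complex.exp (κ * φ x) *
        (κ ^ 2 * A x * symbolC (inverseMetric M a) x (dC φ x) (dC φ x) +
          κ * (2 * symbolC (inverseMetric M a) x (dC φ x) (dC A x) +
            A x * waveOperatorC (inverseMetric M a) φ x) +
          waveOperatorC (inverseMetric M a) A x)).re := by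
  have hx := radius_pos_of_mem_region x.2
  have hG : ∀ μ ν, DifferentiableAt ℝ (fun y ↦ inverseMetric M a y μ ν) x :=
    fun μ ν ↦ (contDiffAt_inverseMetric M a hx μ ν (n := 1)).differentiableAt one_ne_zero
  have hu : ContDiffAt ℝ 2 (fun y ↦ A y * Complex.exp (κ * φ y)) x :=
    hA.mul (contDiffAt_const.mul hφ).cexp
  have hre : ContDiffAt ℝ 2 (fun y ↦ (A y * Complex.exp (κ * φ y)).re) x :=
    Complex.reCLM.contDiff.contDiffAt.comp (x : E4) hu
  rw [dalembertian_eq_divergence M a r₀ hψ x hre, ← waveOperatorC_mul_cexp_of_symm κ hG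
    (inverseMetric_symm M a x) hA hφ, re_waveOperatorC hG hu]
  rfl

/-- **Pointwise bound for `□_g` on a real Gaussian-beam ansatz on Kerr**: for
`ψ = Re(A e^{iλφ})` on `Kerr.region a r₀`, `A, φ ∈ C²` at `x`,
`|□_{g_{M,a}} ψ (x)| ≤ e^{−λ Im φ(x)} (λ² |A| |s(dφ, dφ)| + |λ| |2 s(dφ, dA) + A □φ| + |□A|)(x)`.
[cite: Sbierski2015, arXiv (2.9) and Lemma 5] -/
theorem abs_dalembertian_re_beam_le [Facts] [SliceFacts] (M a r₀ : ℝ) {ψ : region a r₀ → ℝ}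
    {A φ : E4 → ℂ} (lam : ℝ)
    (hψ : ∀ y, ψ y = (A y * Complex.exp (Complex.I * lam * φ y)).re) (x : region a r₀)
    (hA : ContDiffAt ℝ 2 A x) (hφ : ContDiffAt ℝ 2 φ x) :
    |(smoothMetric M a r₀).toPseudoRiemannianMetric.dalembertian ψ x| ≤
      Real.exp (-(lam * (φ x).im)) *
        (lam ^ 2 * ‖A x‖ * ‖symbolC (inverseMetric M a) x (dC φ x) (dC φ x)‖ +
          |lam| * ‖2 * symbolC (inverseMetric M a) x (dC φ x) (dC A x) +
            A x * waveOperatorC (inverseMetric M a) φ x‖ +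
          ‖waveOperatorC (inverseMetric M a) A x‖) := by
  have hx := radius_pos_of_mem_region x.2
  have hG : ∀ μ ν, DifferentiableAt ℝ (fun y ↦ inverseMetric M a y μ ν) x :=
    fun μ ν ↦ (contDiffAt_inverseMetric M a hx μ ν (n := 1)).differentiableAt one_ne_zero
  have hre : ContDiffAt ℝ 2 (fun y ↦ (A y * Complex.exp (Complex.I * lam * φ y)).re) x :=
    Complex.reCLM.contDiff.contDiffAt.comp (x : E4) (contDiffAt_beam lam hA hφ)
  rw [dalembertian_eq_divergence M a r₀ hψ x hre]
  exact abs_waveOperator_re_beam_le lam hG (inverseMetric_symm M a x) hA hφ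

end Kerr

end Literature.Geometry.Lorentzian
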